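import Literature.AlgebraicGeometry.Modules.PushforwardUnitHasRankOfFinrank
import Literature.AlgebraicGeometry.Modules.FittingIdealSheafRank
import Literature.AlgebraicGeometry.Modules.PushforwardClosedImmersionCoh
import Literature.AlgebraicGeometry.AbelianSchemes.AbelianSchemePolarization
import HarnessLib

/-!
# The rank of a finite flat morphism from the rank of `f_* 𝒪_X`: `rk f ≡ n` from `HasRank (f_* 𝒪_X) n` — sketch (O9f), the converse dictionary

Topic `AlgebraicGeometry/Modules`; namespaces `Literature.AlgebraicGeometry.Modules` (§1) and
`Literature.AlgebraicGeometry.AbelianSchemes.AbelianSchemeOver.Polarization` (§2).  THEOREMS ONLY (no definition, no named fact, no instance,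
no notation, no `sorry`).  Cell `hodgecm-mathlib` (D-0151), sub-desk P6b census (O9) add2 A10 **(D2-dict⁻¹)**: ★
`Modules/PushforwardUnitHasRankOfFinrank.hasRank_pushforward_unit_of_finrank_eq` proves `rk f ≡ n ⇒ HasRank (f_* 𝒪_X) n` (`Y` locally
Noetherian); this file proves the CONVERSE — for `f : X → Y` finite and flat with `f_* 𝒪_X` locally free of rank `n` (the tree's
`Motives.HasRank`), Mathlib's pointwise rank `Scheme.Hom.finrank f y` is `n` at every `y` — and the `iff`.  Proof: over an affine open `V ∋ y`,
`rk_y f = rk_{𝔭_y} Γ(X, f⁻¹V)` (★ `finrank_eq_rankAtStalk_of_isAffineOpen`) and `Γ(f_* 𝒪_X, V) = Γ(X, f⁻¹V)` is projective of constant stalk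
rank `n` (★ `hasRank_iff_forall_projective_rankAtStalk`, [StacksProject] 0C3G; `f_* 𝒪_X` is affine-localizing, ★
`isAffineLocalizing_pushforward_of_isAffineHom`, and of affine-finite type, ★ `isAffineFiniteType_pushforward_of_isFinite`).
§2: for a polarisation `λ` finite and flat, **`Polarization.HasDegree d ↔ ∀ y, rk_y λ = d²`** ([MumfordFogartyKirwan1994] Def. 7.2 (ii)
«`ϖ_*(o_X)` locally free of rank `d²`» = ★ `AbelianSchemePolarization.HasDegree`, the cell's booked currency) — so the (O9) organs, typed in
`Scheme.Hom.finrank` currency, are consumable from `HasDegree d` verbatim.  HC_CM is proved only modulo the printed citations until rung 0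
closes; nothing here is about HC.

## References
* [StacksProject] The Stacks Project, Tag 02KA (degree of a finite locally free morphism), Tag 0C3G.
* [GortzWedhorn2020] U. Görtz, T. Wedhorn, *Algebraic Geometry I*, 2nd ed. (2020), Prop. 12.19 and the definition after it (p. 332), Cor. 7.42 (p. 198).
* [MumfordFogartyKirwan1994] D. Mumford, J. Fogarty, F. Kirwan, *GIT*, 3rd ed. (1994), Ch. 7 §2 Definition 7.2 (p. 129).
-/

set_option autoImplicit false

noncomputable section

universe u

open CategoryTheory CategoryTheory.Limits AlgebraicGeometry TopologicalSpace Opposite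
open Literature.AlgebraicGeometry.Motives

namespace Literature.AlgebraicGeometry.Modules

variable {X Y : Scheme.{u}} (f : X ⟶ Y)

/-! ### §1 `HasRank (f_* 𝒪_X) n ⇒ rk f ≡ n`, and the `iff` -/

/-- **`f` finite with `f_* 𝒪_X` locally free of rank `n` is flat**: over every affine open `U ⊆ Y`, `Γ(X, f⁻¹U) = Γ(f_* 𝒪_X, U)` is a
projective, hence flat, `Γ(Y, U)`-module (Stacks 0C3G, ★ `hasRank_iff_forall_projective_rankAtStalk`), and flatness of an affine morphism
is read on the rings of sections over affine opens (Mathlib `targetAffineLocally_affineAnd_iff'`). [cite: StacksProject, Tag 02KA]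
[cite: StacksProject, Tag 0C3G] [cite: GortzWedhorn2020, Prop. 12.19 and the definition after it (p. 332)] -/
theorem flat_of_hasRank_pushforward_unit [IsFinite f] {n : ℕ}
    (h : HasRank ((Scheme.Modules.pushforward f).obj (SheafOfModules.unit _)) n) : Flat f := by
  classical
  let E : Y.Modules := (Scheme.Modules.pushforward f).obj (SheafOfModules.unit _)
  have hloc : IsAffineLocalizing E := isAffineLocalizing_pushforward_of_isAffineHom f IsAffineLocalizing.unit
  have hfinE : IsAffineFiniteType E := isAffineFiniteType_pushforward_of_isFinite f IsAffineFiniteType.unit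
  have happ : ∀ U : Y.Opens, IsAffineOpen U → (f.app U).hom.Flat := fun U hU => by
    obtain ⟨hproj, -⟩ := (hasRank_iff_forall_projective_rankAtStalk hloc hfinE n).mp h ⟨U, hU⟩
    have hfl : Module.Flat Γ(Y, U) Γ(E, U) := Module.Flat.of_projective
    rw [RingHom.Flat]
    exact hfl
  have h1 := (targetAffineLocally_affineAnd_iff' RingHom.Flat.propertyIsLocal.respectsIso f).mpr ⟨inferInstance, happ⟩
  have h2 := ((targetAffineLocally_affineAnd_iff_affineLocally RingHom.Flat.propertyIsLocal f).mp h1).2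
  rwa [← HasRingHomProperty.eq_affineLocally (P := @Flat)] at h2

/-- **`rk_y f = n` for all `y` when `f_* 𝒪_X` is locally free of rank `n`** (`f` finite; flat by the previous lemma): over an affine open
`V ∋ y`, `rk_y f`
is the stalk rank of `Γ(X, f⁻¹V) = Γ(f_* 𝒪_X, V)` at `𝔭_y` (★ `finrank_eq_rankAtStalk_of_isAffineOpen`), which is `n` by Stacks 0C3G
(★ `hasRank_iff_forall_projective_rankAtStalk`). [cite: StacksProject, Tag 02KA] [cite: StacksProject, Tag 0C3G]
[cite: GortzWedhorn2020, Prop. 12.19 and the definition after it (p. 332)] -/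
theorem finrank_eq_of_hasRank_pushforward_unit [IsFinite f] {n : ℕ}
    (h : HasRank ((Scheme.Modules.pushforward f).obj (SheafOfModules.unit _)) n) (y : Y) : f.finrank y = n := by
  classical
  haveI : Flat f := flat_of_hasRank_pushforward_unit f h
  let E : Y.Modules := (Scheme.Modules.pushforward f).obj (SheafOfModules.unit _)
  have hloc : IsAffineLocalizing E := isAffineLocalizing_pushforward_of_isAffineHom f IsAffineLocalizing.unit
  have hfinE : IsAffineFiniteType E := isAffineFiniteType_pushforward_of_isFinite f IsAffineFiniteType.unit
  obtain ⟨_, ⟨V, hV, rfl⟩, hyV, -⟩ :=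
    Y.isBasis_affineOpens.exists_subset_of_mem_open (Set.mem_univ y) isOpen_univ
  obtain ⟨-, hrk⟩ := (hasRank_iff_forall_projective_rankAtStalk hloc hfinE n).mp h ⟨V, hV⟩
  rw [finrank_eq_rankAtStalk_of_isAffineOpen f hV ⟨y, hyV⟩]
  exact hrk (hV.primeIdealOf ⟨y, hyV⟩)

/-- **The dictionary as an `iff`** (`Y` locally Noetherian for `⇐`, ★ `hasRank_pushforward_unit_of_finrank_eq`): `f_* 𝒪_X` is locally free
of rank `n` iff `rk_y f = n` for all `y`. [cite: StacksProject, Tag 02KA] [cite: GortzWedhorn2020, Prop. 12.19 and the definition after it (p. 332)] -/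
theorem hasRank_pushforward_unit_iff_finrank_eq [IsFinite f] [Flat f] [IsLocallyNoetherian Y] (n : ℕ) :
    HasRank ((Scheme.Modules.pushforward f).obj (SheafOfModules.unit _)) n ↔ ∀ y : Y, f.finrank y = n :=
  ⟨fun h y => finrank_eq_of_hasRank_pushforward_unit f h y, hasRank_pushforward_unit_of_finrank_eq f n⟩

end Literature.AlgebraicGeometry.Modules

/-! ### §2 Polarisations: `HasDegree d ↔ rk λ ≡ d²` -/

namespace Literature.AlgebraicGeometry.AbelianSchemes.AbelianSchemeOver

open Literature.AlgebraicGeometry.Modules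

variable {S : Scheme.{u}} {A : AbelianSchemeOver S} {D : A.DualPair} (pol : A.Polarization D)

/-- **`HasDegree d ⇒ rk_y λ = d²` at every `y ∈ Â`** for `λ` finite. [cite: MumfordFogartyKirwan1994, Ch. 7 §2 Definition 7.2 (p. 129)]
[cite: StacksProject, Tag 02KA] -/
theorem Polarization.finrank_lam_left_eq_of_hasDegree [IsFinite pol.lam.left] {d : ℕ} (h : pol.HasDegree d) (y : D.hat.X.left) :
    pol.lam.left.finrank y = d ^ 2 :=
  finrank_eq_of_hasRank_pushforward_unit pol.lam.left ((pol.hasDegree_iff d).mp h) y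

/-- **`HasDegree d ⇒ λ` is flat** (`λ` finite; ★ `flat_of_hasRank_pushforward_unit`). [cite: MumfordFogartyKirwan1994, Ch. 7 §2 Definition 7.2 (p. 129)]
[cite: StacksProject, Tag 02KA] -/
theorem Polarization.flat_lam_left_of_hasDegree [IsFinite pol.lam.left] {d : ℕ} (h : pol.HasDegree d) : Flat pol.lam.left :=
  flat_of_hasRank_pushforward_unit pol.lam.left ((pol.hasDegree_iff d).mp h)

/-- **`HasDegree d ↔ ∀ y, rk_y λ = d²`** for `λ` finite and flat over a locally Noetherian `Â` (e.g. `S` locally Noetherian).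
[cite: MumfordFogartyKirwan1994, Ch. 7 §2 Definition 7.2 (p. 129)] [cite: StacksProject, Tag 02KA] -/
theorem Polarization.hasDegree_iff_finrank_lam_left_eq [IsFinite pol.lam.left] [Flat pol.lam.left] [IsLocallyNoetherian D.hat.X.left]
    (d : ℕ) : pol.HasDegree d ↔ ∀ y : D.hat.X.left, pol.lam.left.finrank y = d ^ 2 := by
  rw [pol.hasDegree_iff d]
  exact hasRank_pushforward_unit_iff_finrank_eq pol.lam.left (d ^ 2)

end Literature.AlgebraicGeometry.AbelianSchemes.AbelianSchemeOver

end
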